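import Literature.MathematicalPhysics.QuantumFieldTheory.Balaban1983to89.B6BlockHolderLipschitzV1
import Literature.MathematicalPhysics.QuantumFieldTheory.Balaban1983to89.B6BlockDecayGradCompositesV1

/-!
# `Balaban1983to89.B6BlockHolderLipFactorsV1` — T. Bałaban, *Propagators and renormalization transformations for lattice gauge theories. II*,
# Commun. Math. Phys. **96** (1984) 223–250 [Balaban1984PropagatorsII], Prop. 2.5 p. 246, towards the HÖLDER member `‖ζG∇*J‖_α` of (1.111) for
# the two-scale `G` of (2.90): the UNDIFFERENTIATED first factors `∂H′_j`, `H_j`, `G^{(w′)}`, `K₂*`, `G̃_j`, `H_jC̃^{(j)}_ΛH_j*` of the transposed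
# representation (2.129)∘`∇_λ*` are LIPSCHITZ in the output, uniformly — file 7 of the Hölder programme (p38)

statement-level skeleton of published theorems with citation tags; proofs where landed; nothing here is a claim about the Yang–Mills mass gap

p. 246 (Prop. 2.5): *"… satisfies all the inequalities (1.110)–(1.114) of the Proposition 1.2 with a positive constant δ₂ instead of δ₀. This
constant depends on d and L only."*; p. 246: *"The operators H′_j … derivatives … up to third order … are uniformly bounded and have a uniform
exponential decay"*; [4] (1.109), (1.111) p. 35.

WHAT THIS FILE DOES.  In `G∇_λ* = K₁∇_λ* + (I − K₂)*[M∇_λ* − M(K₂∇_λ*)]` (p22's files 13–14) the Hölder quotient in the output variable falls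
on the FIRST factors `∂H′_j` (of `K₁ = ∂H′_jC(∂H′_j)*` and of `K₂* = ∂H′_jC(∂ΔH′_j)*`), `H_j` (of `H_jC̃(∇_λH_j)*`, `H_jC̃H_j*` and of
`G̃_j = (I − H_jQ_j)G^{(n^{d+1})}`) and `G^{(n^{d+1})}`; each is LIPSCHITZ in the output because ALL its fine differences `D_μ∘f` have uniform block
bounds (p22 file 8: `blockBound_DgradHp`, `blockBound_DHj`, `blockBound_DGE_scaling`), by file 2's `holderBound_of_blockBound_D`:
`holderBound_gradHp`, `holderBound_Hj` (fixed torus), `holderBound_GE_scaling`, and the composites `holderBound_K2adj_scaling`,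
`holderBound_Gt_scaling`, `holderBound_HjCtHj_scaling` (pair bound of the first factor × block bounds of the tail, file 1's `holderBound_comp`),
all of the form `(C·t, δ)`, `t = |x − x′|_∞/n ≤ 1`, with `δ > 0`, `C ≥ 0` depending on `d, L` (and the weight window) only.

DICTIONARY / DIVERGENCES as in files 1–6 and p22's files 1–14; no new definition, no new hypothesis.  NOT summit progress.
Unit `lit-balaban-p38` (gen 21), 2026-08-22.
-/

noncomputable section

open scoped InnerProductSpace BigOperators
open Finset

namespace Literature.MathematicalPhysics.QuantumFieldTheory.Balaban1983to89.B6BlockHolderLipFactorsV1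

open LatticeFieldCalculus B5SectBStatements B5Eq117TorusCarriers B6SectADomainsV1 B6SectAOperatorsV1 B6SectAVectorModelV1 B6SectCOperators
  B6SectCTwoScaleV1 B6SectCTwoScaleV1Lattice B5Eq118OneStroke
open BalabanImbrieJaffe1984to88.BIJ85AxialPropagator411 (BondSpace)
open B4Sect5Torus (IsPseudoDist SumBound)
open B4TorusKernel (periodConst)
open B4TorusKernel.MultiPeriod (torusSupNorm torusSupNorm_nonneg)
open B4Sect5Proof (latticeConst latticeConst_nonneg)
open B5Hk163Decay (MG163 MG163_nonneg)
open B5Hk163Strip (kappaN kappaN_pos kappa163 kappa163_pos)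
open B5Hk163TorusHolderDecay (CdecD CdecD_nonneg)
open B5Kernel166Decay (periodConst_pos)
open B6LowerBound2153Torus (rep)
open B6Hprime2132Holder (MGHD)
open B6Repr2129Operator (adjoint_K2)
open B6BlockDecayCalculus (blockBound_comp torusDist_isPseudoDist torusDist_sumBound)
open B6BlockDecayHjCovV1 (blockBound_Hj_adjoint)
open B6BlockDecayHprimeCovV1 (MGHD_nonneg blockBound_gradLapHp_adjoint blockBound_C_of_entry cov_entry_uniform)
open B6BlockDecayGtV1 (Gt_eq_comp_GE blockBound_GE_scaling blockBound_Qv)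
open B6BlockDecayGradFactorsV1 (blockBound_DgradHp blockBound_DHj blockBound_DGE_scaling blockBound_Ct_scaling)
open B6BlockHolderCalculus (holderBound_comp holderBound_sub holderBound_mono)
open B6BlockHolderLipschitzV1 (holderBound_of_blockBound_D)

/-! ## §1  The first factors `∂H′_j`, `H_j` are Lipschitz in the output (fixed torus) -/

section Fixed

variable {d L m K : ℕ} [NeZero L] {hd : 1 ≤ d + 1} {hL : Odd L ∧ 1 < L} {c : ℝ} (hc : c ≠ 0) {j : ℕ}
  (Λ' : Finset (Site (⟨d + 1, L, m, K, hd, hL⟩ : Params) (j + 1)))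

/-- **THE PAIR (LIPSCHITZ-IN-THE-OUTPUT) BOUND OF `∂H′_j`**: for fine bonds `b₁ = ⟨x, ν⟩`, `b₂ = ⟨x′, ν⟩` with `|x − x′|_∞ ≤ n` and every unit site `y`,
`Σ_{y′ = y}|(∂H′_j)(e_{y′})_{b₁} − (∂H′_j)(e_{y′})_{b₂}| ≤ (d+1)(|c|/n)A₂e^{κ}·(|x − x′|_∞/n)·e^{−κ|y(x) − y|_T}`, `κ = κ_N(d+1)/(d+1)` — all fine
differences `D_μ∂H′_j` have the block bound `((|c|/n)A₂, κ)` (p22 file 8's `blockBound_DgradHp`, second derivatives of `H′_j`), file 2.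
[cite: Balaban1984PropagatorsII, p.246 (text after (2.132)); Balaban1984PropagatorsI, (1.109) p.35] -/
theorem holderBound_gradHp (hj : j ≤ (⟨d + 1, L, m, K, hd, hL⟩ : Params).m + (⟨d + 1, L, m, K, hd, hL⟩ : Params).K) (w : CIdx j Λ' → ℝ)
    (b₁ b₂ : PBond (⟨d + 1, L, m, K, hd, hL⟩ : Params) 0) (hdir : b₁.dir = b₂.dir) (hle : supDist b₁.src b₂.src ≤ L ^ j) (y : Site (⟨d + 1, L, m, K, hd, hL⟩ : Params) j) :
    ∑ y' ∈ univ.filter (fun y' : Site (⟨d + 1, L, m, K, hd, hL⟩ : Params) j => y' = y),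
        |((tsV1 hc Λ' w).grad ∘ₗ (tsV1 hc Λ' w).hP) (EuclideanSpace.single y' (1 : ℝ)) b₁ -
         ((tsV1 hc Λ' w).grad ∘ₗ (tsV1 hc Λ' w).hP) (EuclideanSpace.single y' (1 : ℝ)) b₂| ≤
      ((d + 1 : ℕ) : ℝ) * (|c| / (L : ℝ) ^ j * (MGHD (d + 1) 2 * periodConst (kappaN (d + 1)) d) * ((1 : ℕ) : ℝ)) *
        Real.exp (kappaN (d + 1) / ((d : ℝ) + 1)) * ((supDist b₁.src b₂.src : ℝ) / (L : ℝ) ^ j) *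
        Real.exp (-(kappaN (d + 1) / ((d : ℝ) + 1) * torusSupNorm (Mk (⟨d + 1, L, m, K, hd, hL⟩ : Params) j)
            (rep (Mk (⟨d + 1, L, m, K, hd, hL⟩ : Params) j) (iterBlockOf j b₁.src) - rep (Mk (⟨d + 1, L, m, K, hd, hL⟩ : Params) j) y))) := by
  have hLj : (0 : ℝ) < (L : ℝ) ^ j := pow_pos (Nat.cast_pos.2 (Nat.pos_of_ne_zero (NeZero.ne L))) _
  exact holderBound_of_blockBound_D hj _ (fun y : Site (⟨d + 1, L, m, K, hd, hL⟩ : Params) j => y)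
    (by have := MGHD_nonneg (d + 1) 2; have := periodConst_pos (kappaN_pos (d + 1)) d; positivity)
    (div_nonneg (kappaN_pos _).le (by positivity))
    (fun μ b₀ y => blockBound_DgradHp hc hj Λ' w μ b₀ y) b₁ b₂ hdir hle y

variable {w : CIdx j Λ' → ℝ}

/-- **THE PAIR (LIPSCHITZ-IN-THE-OUTPUT) BOUND OF `H_j`** (unit bonds → fine bonds): for fine bonds `b₁ = ⟨x, ν⟩`, `b₂ = ⟨x′, ν⟩` with
`|x − x′|_∞ ≤ n` and every unit site `y`, `Σ_{b : b₋ = y}|H_j(e_b)_{b₁} − H_j(e_b)_{b₂}| ≤ (d+1)C_D(d+1)e^{κ_H}·(|x − x′|_∞/n)·e^{−κ_H|y(x) − y|_T}`,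
`κ_H = κ₁₆₃(d+1)/(d+1)` — all fine differences `D_μH_j` have the block bound `(C_D(d+1), κ_H)` (p22 file 8's `blockBound_DHj` = b05's (1.63)
derivative decay), file 2. [cite: Balaban1984PropagatorsII, (2.130) p.246; Balaban1984PropagatorsI, p.29 lines 1–2, (1.109) p.35] -/
theorem holderBound_Hj [DecidableEq (PBond (⟨d + 1, L, m, K, hd, hL⟩ : Params) j)] (hj : j + 1 ≤ (⟨d + 1, L, m, K, hd, hL⟩ : Params).m + (⟨d + 1, L, m, K, hd, hL⟩ : Params).K) (hw : ∀ i, 0 < w i)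
    (b₁ b₂ : PBond (⟨d + 1, L, m, K, hd, hL⟩ : Params) 0) (hdir : b₁.dir = b₂.dir) (hle : supDist b₁.src b₂.src ≤ L ^ j) (y : Site (⟨d + 1, L, m, K, hd, hL⟩ : Params) j) :
    ∑ b ∈ univ.filter (fun b : PBond (⟨d + 1, L, m, K, hd, hL⟩ : Params) j => b.src = y),
        |(tsV1 hc Λ' w).Hj (EuclideanSpace.single b (1 : ℝ)) b₁ - (tsV1 hc Λ' w).Hj (EuclideanSpace.single b (1 : ℝ)) b₂| ≤
      ((d + 1 : ℕ) : ℝ) * (CdecD d * ((1 * (d + 1) : ℕ) : ℝ)) * Real.exp (kappa163 (d + 1) / ((d : ℝ) + 1)) *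
        ((supDist b₁.src b₂.src : ℝ) / (L : ℝ) ^ j) *
        Real.exp (-(kappa163 (d + 1) / ((d : ℝ) + 1) * torusSupNorm (Mk (⟨d + 1, L, m, K, hd, hL⟩ : Params) j)
            (rep (Mk (⟨d + 1, L, m, K, hd, hL⟩ : Params) j) (iterBlockOf j b₁.src) - rep (Mk (⟨d + 1, L, m, K, hd, hL⟩ : Params) j) y))) :=
  holderBound_of_blockBound_D (Nat.le_of_succ_le hj) _ (fun b : PBond (⟨d + 1, L, m, K, hd, hL⟩ : Params) j => b.src)
    (mul_nonneg (CdecD_nonneg (d := d)) (Nat.cast_nonneg _)) (div_nonneg (kappa163_pos _).le (by positivity))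
    (fun μ b₀ y => blockBound_DHj hc hj Λ' hw μ b₀ y) b₁ b₂ hdir hle y

end Fixed

/-! ## §2  `G^{(w′)}`, `K₂*`, `G̃_j`, `H_jC̃^{(j)}_ΛH_j*` at the scaling `c = L^j` -/

section Scaling

variable {d L m K : ℕ} {hd : 1 ≤ d + 1} {hL : Odd L ∧ 1 < L} {j : ℕ}

open Classical in
/-- **THE PAIR (LIPSCHITZ-IN-THE-OUTPUT) BOUND OF `G^{(w′)}`** (`c = L^j`, `w′ = a·n^{d+1}`): `δ > 0`, `C ≥ 0` depending on `d, L, a` only with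
`Σ_{b₀′ : y(b₀′₋) = y}|G^{(w′)}(e_{b₀′})_{b₁} − G^{(w′)}(e_{b₀′})_{b₂}| ≤ C·(|x − x′|_∞/n)·e^{−δ|y(x) − y|_T}` — all fine differences
`∇_μG^{(w′)}` have the block bound `(O(1), δ₀)` of [4] Prop. 1.2 (1.110)₁ (p22 file 8's `blockBound_DGE_scaling`), file 2.
[cite: Balaban1984PropagatorsI, Prop. 1.2 (1.110) p.35, (1.109) p.35; Balaban1984PropagatorsII, p.246] -/
theorem holderBound_GE_scaling (d L : ℕ) (hd : 1 ≤ d + 1) (hL : Odd L ∧ 1 < L) {a : ℝ} (ha : 0 < a) :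
    ∃ δ : ℝ, 0 < δ ∧ ∃ C : ℝ, 0 ≤ C ∧ ∀ (m K j : ℕ)
      (hj' : j ≤ (⟨d + 1, L, m, K, hd, hL⟩ : Params).m + (⟨d + 1, L, m, K, hd, hL⟩ : Params).K) (hc : ((L : ℝ) ^ j) ≠ 0)
      (hw' : (0 : ℝ) < a * ((L : ℝ) ^ j) ^ (d + 1))
      (b₁ b₂ : PBond (⟨d + 1, L, m, K, hd, hL⟩ : Params) 0) (_hdir : b₁.dir = b₂.dir) (_hle : supDist b₁.src b₂.src ≤ L ^ j) (y : Site (⟨d + 1, L, m, K, hd, hL⟩ : Params) j),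
      ∑ b₀' ∈ univ.filter (fun b₀' : PBond (⟨d + 1, L, m, K, hd, hL⟩ : Params) 0 => iterBlockOf j b₀'.src = y),
          |(GE (Domains.whole (P := (⟨d + 1, L, m, K, hd, hL⟩ : Params)) j hj') hc (w := fun _ => a * ((L : ℝ) ^ j) ^ (d + 1)) (fun _ => hw')) (EuclideanSpace.single b₀' (1 : ℝ)) b₁ - (GE (Domains.whole (P := (⟨d + 1, L, m, K, hd, hL⟩ : Params)) j hj') hc (w := fun _ => a * ((L : ℝ) ^ j) ^ (d + 1)) (fun _ => hw')) (EuclideanSpace.single b₀' (1 : ℝ)) b₂| ≤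
        C * (((supDist b₁.src b₂.src : ℕ) : ℝ) / (L : ℝ) ^ j) * Real.exp (-(δ * torusSupNorm (Mk (⟨d + 1, L, m, K, hd, hL⟩ : Params) j)
            (rep (Mk (⟨d + 1, L, m, K, hd, hL⟩ : Params) j) (iterBlockOf j b₁.src) - rep (Mk (⟨d + 1, L, m, K, hd, hL⟩ : Params) j) y))) := by
  obtain ⟨δ, hδ, C, hC, hD⟩ := blockBound_DGE_scaling d L hd hL ha
  refine ⟨δ, hδ, ((d + 1 : ℕ) : ℝ) * C * Real.exp δ, by positivity, ?_⟩
  intro m K j hj' hc hw' b₁ b₂ hdir hle y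
  exact holderBound_of_blockBound_D hj' _ (fun b₀ : PBond (⟨d + 1, L, m, K, hd, hL⟩ : Params) 0 => iterBlockOf j b₀.src) hC hδ.le
    (fun μ b₀ y => hD m K j hj' hc hw' μ b₀ y) b₁ b₂ hdir hle y

open Classical in
/-- **THE PAIR (LIPSCHITZ-IN-THE-OUTPUT) BOUND OF `K₂* = ∂H′_jC^{(j)}_Λ(∂ΔH′_j)*`** (at `c = L^j`; p22's `adjoint_K2`): `δ > 0`, `C ≥ 0` depending on
`d, L` only; pair bound `(C·t, δ)` — first factor `∂H′_j` (§1), tail `C^{(j)}_Λ(∂ΔH′_j)*` (p22 files 2, 4).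
[cite: Balaban1984PropagatorsII, Prop. 2.5 p.246, (2.129) p.245; Balaban1984PropagatorsI, (1.111) p.35] -/
theorem holderBound_K2adj_scaling (d L : ℕ) (hd : 1 ≤ d + 1) (hL : Odd L ∧ 1 < L) :
    ∃ δ : ℝ, 0 < δ ∧ ∃ C : ℝ, 0 ≤ C ∧ ∀ (m K : ℕ) (j : ℕ) (hc : ((L : ℝ) ^ j) ≠ 0)
      (_hj : j + 1 ≤ (⟨d + 1, L, m, K, hd, hL⟩ : Params).m + (⟨d + 1, L, m, K, hd, hL⟩ : Params).K)
      (Λ' : Finset (Site (⟨d + 1, L, m, K, hd, hL⟩ : Params) (j + 1))) (w : CIdx j Λ' → ℝ) (_hw : ∀ i, 0 < w i)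
      (b₁ b₂ : PBond (⟨d + 1, L, m, K, hd, hL⟩ : Params) 0) (_hdir : b₁.dir = b₂.dir) (_hle : supDist b₁.src b₂.src ≤ L ^ j) (y : Site (⟨d + 1, L, m, K, hd, hL⟩ : Params) j),
      ∑ b₀' ∈ univ.filter (fun b₀' : PBond (⟨d + 1, L, m, K, hd, hL⟩ : Params) 0 => iterBlockOf j b₀'.src = y),
          |(LinearMap.adjoint (tsV1 hc Λ' w).K2) (EuclideanSpace.single b₀' (1 : ℝ)) b₁ -
           (LinearMap.adjoint (tsV1 hc Λ' w).K2) (EuclideanSpace.single b₀' (1 : ℝ)) b₂| ≤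
        C * (((supDist b₁.src b₂.src : ℕ) : ℝ) / (L : ℝ) ^ j) * Real.exp (-(δ * torusSupNorm (Mk (⟨d + 1, L, m, K, hd, hL⟩ : Params) j)
            (rep (Mk (⟨d + 1, L, m, K, hd, hL⟩ : Params) j) (iterBlockOf j b₁.src) - rep (Mk (⟨d + 1, L, m, K, hd, hL⟩ : Params) j) y))) := by
  obtain ⟨δC, hδC, E, hE, hCov⟩ := cov_entry_uniform d L hd hL
  set κH : ℝ := kappaN (d + 1) / ((d : ℝ) + 1) with hκH
  have hκH0 : 0 < κH := div_pos (kappaN_pos _) (by positivity)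
  set δ₁ : ℝ := min (δC / 2) κH with hδ₁
  set δ₂ : ℝ := min (δC / 2) (κH / 2) with hδ₂
  have hδ₁0 : 0 < δ₁ := lt_min (half_pos hδC) hκH0
  have hδ₂0 : 0 < δ₂ := lt_min (half_pos hδC) (half_pos hκH0)
  have hδ₁C : δ₁ < δC := lt_of_le_of_lt (min_le_left _ _) (half_lt_self hδC)
  have hδ₁H : δ₁ ≤ κH := min_le_right _ _
  have hδ₂₁ : δ₂ ≤ δ₁ := le_min (min_le_left _ _) ((min_le_right _ _).trans (half_le_self hκH0.le))
  have hδ₂H : δ₂ < κH := lt_of_le_of_lt (min_le_right _ _) (half_lt_self hκH0)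
  set K₁ : ℝ := latticeConst (d + 1) (δC - δ₁) with hK₁
  set K₂ : ℝ := latticeConst (d + 1) (κH - δ₂) with hK₂
  have hK₁0 : 0 ≤ K₁ := latticeConst_nonneg _ (by linarith)
  have hK₂0 : 0 ≤ K₂ := latticeConst_nonneg _ (by linarith)
  have hL0 : 0 < L := by have := hL.2; omega
  haveI : NeZero L := ⟨by omega⟩
  have hLp : (0 : ℝ) < L := by exact_mod_cast hL0
  set Af : ℝ := ((d + 1 : ℕ) : ℝ) * (MGHD (d + 1) 2 * periodConst (kappaN (d + 1)) d) * Real.exp κH with hAf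
  have hAf0 : 0 ≤ Af := by
    have := MGHD_nonneg (d + 1) 2
    have := periodConst_pos (kappaN_pos (d + 1)) d
    positivity
  set Ah : ℝ := ((d + 1 : ℕ) : ℝ) * (MGHD (d + 1) 3 * periodConst (kappaN (d + 1)) d) * Real.exp (kappaN (d + 1) / ((d : ℝ) + 1)) with hAh
  have hAh0 : 0 ≤ Ah := by
    have := MGHD_nonneg (d + 1) 3
    have := periodConst_pos (kappaN_pos (d + 1)) d
    positivity
  set C : ℝ := Af * (E * (Ah * ((d + 1 : ℕ) : ℝ)) * K₁) * K₂ with hC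
  have hC0 : 0 ≤ C := by positivity
  refine ⟨δ₂, hδ₂0, C, hC0, ?_⟩
  intro m K j hc hj Λ' w hw b₁ b₂ hdir hle y
  have hj' : j ≤ m + K := Nat.le_of_succ_le hj
  set n : ℝ := ((L : ℝ) ^ j) ^ (d + 1) with hn
  have hn0 : 0 < n := by positivity
  have hLj : (0 : ℝ) < (L : ℝ) ^ j := by positivity
  have ht0 : 0 ≤ (((supDist b₁.src b₂.src : ℕ) : ℝ) / (L : ℝ) ^ j) := by positivity
  have hρ : IsPseudoDist (fun t t' : Site (⟨d + 1, L, m, K, hd, hL⟩ : Params) j => torusSupNorm (Mk (⟨d + 1, L, m, K, hd, hL⟩ : Params) j) (rep (Mk (⟨d + 1, L, m, K, hd, hL⟩ : Params) j) t - rep (Mk (⟨d + 1, L, m, K, hd, hL⟩ : Params) j) t')) := torusDist_isPseudoDist (Mk (⟨d + 1, L, m, K, hd, hL⟩ : Params) j)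
  have hK : SumBound (fun t t' : Site (⟨d + 1, L, m, K, hd, hL⟩ : Params) j => torusSupNorm (Mk (⟨d + 1, L, m, K, hd, hL⟩ : Params) j) (rep (Mk (⟨d + 1, L, m, K, hd, hL⟩ : Params) j) t - rep (Mk (⟨d + 1, L, m, K, hd, hL⟩ : Params) j) t')) (fun a => latticeConst (d + 1) a) := torusDist_sumBound (Mk (⟨d + 1, L, m, K, hd, hL⟩ : Params) j)
  have h1 : |(L : ℝ) ^ j| / (L : ℝ) ^ j = 1 := by rw [abs_of_pos hLj, div_self hc]
  have hcast : (((L ^ j) ^ (d + 1) * (d + 1) : ℕ) : ℝ) = n * ((d + 1 : ℕ) : ℝ) := by rw [hn]; push_cast; ring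
  have hθ : ((L : ℝ) ^ j / (L : ℝ) ^ j) ^ 4 * ((L : ℝ) ^ j) ^ (d + 1) = n := by rw [div_self hc, one_pow, one_mul]
  -- the first factor `∂H′_j`: pair bound `(A_f·t, κ)` (§1)
  have hf : ∀ y' : Site (⟨d + 1, L, m, K, hd, hL⟩ : Params) j, ∑ y'' ∈ univ.filter (fun y'' : Site (⟨d + 1, L, m, K, hd, hL⟩ : Params) j => y'' = y'),
      |((tsV1 hc Λ' w).grad ∘ₗ (tsV1 hc Λ' w).hP) (EuclideanSpace.single y'' (1 : ℝ)) b₁ -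
       ((tsV1 hc Λ' w).grad ∘ₗ (tsV1 hc Λ' w).hP) (EuclideanSpace.single y'' (1 : ℝ)) b₂| ≤
      Af * (((supDist b₁.src b₂.src : ℕ) : ℝ) / (L : ℝ) ^ j) * Real.exp (-(κH * torusSupNorm (Mk (⟨d + 1, L, m, K, hd, hL⟩ : Params) j) (rep (Mk (⟨d + 1, L, m, K, hd, hL⟩ : Params) j) (iterBlockOf j b₁.src) - rep (Mk (⟨d + 1, L, m, K, hd, hL⟩ : Params) j) y'))) := by
    intro y'
    refine (holderBound_gradHp hc Λ' hj' w b₁ b₂ hdir hle y').trans (le_of_eq ?_)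
    rw [h1, hAf, Nat.cast_one]; ring
  -- the tail factors (p22 file 4): `(∂ΔH′_j)*`, `C^{(j)}_Λ`
  have hTs : ∀ (y' y : Site (⟨d + 1, L, m, K, hd, hL⟩ : Params) j),
      ∑ b₀ ∈ univ.filter (fun b₀ : PBond (⟨d + 1, L, m, K, hd, hL⟩ : Params) 0 => iterBlockOf j b₀.src = y),
          |LinearMap.adjoint ((tsV1 hc Λ' w).grad ∘ₗ (tsV1 hc Λ' w).lap ∘ₗ (tsV1 hc Λ' w).hP) (EuclideanSpace.single b₀ (1 : ℝ)) y'| ≤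
        Ah * (n * ((d + 1 : ℕ) : ℝ)) * Real.exp (-(κH * torusSupNorm (Mk (⟨d + 1, L, m, K, hd, hL⟩ : Params) j) (rep (Mk (⟨d + 1, L, m, K, hd, hL⟩ : Params) j) y' - rep (Mk (⟨d + 1, L, m, K, hd, hL⟩ : Params) j) y))) := by
    intro y' y
    refine (blockBound_gradLapHp_adjoint hc hj' Λ' w y' y).trans (le_of_eq ?_)
    rw [h1, hcast]; ring
  have hCb : ∀ (x y : Site (⟨d + 1, L, m, K, hd, hL⟩ : Params) j),
      ∑ x' ∈ univ.filter (fun x' : Site (⟨d + 1, L, m, K, hd, hL⟩ : Params) j => x' = y), |(tsV1 hc Λ' w).C (EuclideanSpace.single x' (1 : ℝ)) x| ≤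
        E / n * Real.exp (-(δC * torusSupNorm (Mk (⟨d + 1, L, m, K, hd, hL⟩ : Params) j) (rep (Mk (⟨d + 1, L, m, K, hd, hL⟩ : Params) j) x - rep (Mk (⟨d + 1, L, m, K, hd, hL⟩ : Params) j) y))) := by
    intro x y
    refine (blockBound_C_of_entry hc Λ' w (E := E / n) (δ := δC) (by positivity) (fun x x' => ?_) x y).trans (le_of_eq ?_)
    · have h := hCov m K ((L : ℝ) ^ j) hc j hj Λ' w hw x x'
      rwa [hθ] at h
    · rw [Nat.cast_one, mul_one]
  have hg : ∀ (x y : Site (⟨d + 1, L, m, K, hd, hL⟩ : Params) j), ∑ b₀ ∈ univ.filter (fun b₀ : PBond (⟨d + 1, L, m, K, hd, hL⟩ : Params) 0 => iterBlockOf j b₀.src = y),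
      |((tsV1 hc Λ' w).C ∘ₗ LinearMap.adjoint ((tsV1 hc Λ' w).grad ∘ₗ (tsV1 hc Λ' w).lap ∘ₗ (tsV1 hc Λ' w).hP)) (EuclideanSpace.single b₀ (1 : ℝ)) x| ≤
      E / n * (Ah * (n * ((d + 1 : ℕ) : ℝ))) * K₁ *
        Real.exp (-(δ₁ * torusSupNorm (Mk (⟨d + 1, L, m, K, hd, hL⟩ : Params) j) (rep (Mk (⟨d + 1, L, m, K, hd, hL⟩ : Params) j) x - rep (Mk (⟨d + 1, L, m, K, hd, hL⟩ : Params) j) y))) := by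
    intro x y
    have h := blockBound_comp hρ hK (tsV1 hc Λ' w).C (LinearMap.adjoint ((tsV1 hc Λ' w).grad ∘ₗ (tsV1 hc Λ' w).lap ∘ₗ (tsV1 hc Λ' w).hP))
      (fun x : Site (⟨d + 1, L, m, K, hd, hL⟩ : Params) j => x) (fun x : Site (⟨d + 1, L, m, K, hd, hL⟩ : Params) j => x) (fun b₀ : PBond (⟨d + 1, L, m, K, hd, hL⟩ : Params) 0 => iterBlockOf j b₀.src)
      (by positivity : 0 ≤ E / n) (by positivity : 0 ≤ Ah * (n * ((d + 1 : ℕ) : ℝ))) hδ₁0.le hδ₁H hδ₁C hCb hTs x y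
    rw [hK₁]; exact h
  rw [adjoint_K2 (isLattice Λ' hc hj hw) (positive Λ' hc hj w)]
  have h := holderBound_comp hρ hK ((tsV1 hc Λ' w).grad ∘ₗ (tsV1 hc Λ' w).hP)
    ((tsV1 hc Λ' w).C ∘ₗ LinearMap.adjoint ((tsV1 hc Λ' w).grad ∘ₗ (tsV1 hc Λ' w).lap ∘ₗ (tsV1 hc Λ' w).hP))
    (fun x : Site (⟨d + 1, L, m, K, hd, hL⟩ : Params) j => x) (fun b₀ : PBond (⟨d + 1, L, m, K, hd, hL⟩ : Params) 0 => iterBlockOf j b₀.src) b₁ b₂ (iterBlockOf j b₁.src)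
    (by positivity : 0 ≤ Af * (((supDist b₁.src b₂.src : ℕ) : ℝ) / (L : ℝ) ^ j)) (by positivity : 0 ≤ E / n * (Ah * (n * ((d + 1 : ℕ) : ℝ))) * K₁)
    hδ₂0.le hδ₂₁ hδ₂H hf hg y
  refine h.trans (le_of_eq ?_)
  have hn' : E / n * (Ah * (n * ((d + 1 : ℕ) : ℝ))) = E * (Ah * ((d + 1 : ℕ) : ℝ)) := by
    field_simp
  rw [hn', hC, hK₁, hK₂]
  ring

open Classical in
/-- **THE PAIR (LIPSCHITZ-IN-THE-OUTPUT) BOUND OF `G̃_j`** (at `c = L^j`): `δ > 0`, `C ≥ 0` depending on `d, L` only; pair bound `(C·t, δ)` —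
`G̃_j = G^{(n^{d+1})} − H_j(Q_jG^{(n^{d+1})})` (p22 file 6's `Gt_eq_comp_GE`): `G^{(n^{d+1})}` (`holderBound_GE_scaling`), `H_j` (§1) × the block
bound of `Q_jG^{(n^{d+1})}` (p22 file 6). [cite: Balaban1984PropagatorsII, (2.131) p.246, Prop. 2.5 p.246; Balaban1984PropagatorsI, (1.111) p.35] -/
theorem holderBound_Gt_scaling (d L : ℕ) (hd : 1 ≤ d + 1) (hL : Odd L ∧ 1 < L) :
    ∃ δ : ℝ, 0 < δ ∧ ∃ C : ℝ, 0 ≤ C ∧ ∀ (m K : ℕ) (j : ℕ) (hc : ((L : ℝ) ^ j) ≠ 0)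
      (_hj : j + 1 ≤ (⟨d + 1, L, m, K, hd, hL⟩ : Params).m + (⟨d + 1, L, m, K, hd, hL⟩ : Params).K)
      (Λ' : Finset (Site (⟨d + 1, L, m, K, hd, hL⟩ : Params) (j + 1))) (w : CIdx j Λ' → ℝ) (_hw : ∀ i, 0 < w i)
      (b₁ b₂ : PBond (⟨d + 1, L, m, K, hd, hL⟩ : Params) 0) (_hdir : b₁.dir = b₂.dir) (_hle : supDist b₁.src b₂.src ≤ L ^ j) (y : Site (⟨d + 1, L, m, K, hd, hL⟩ : Params) j),
      ∑ b₀' ∈ univ.filter (fun b₀' : PBond (⟨d + 1, L, m, K, hd, hL⟩ : Params) 0 => iterBlockOf j b₀'.src = y),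
          |(tsV1 hc Λ' w).Gt (EuclideanSpace.single b₀' (1 : ℝ)) b₁ - (tsV1 hc Λ' w).Gt (EuclideanSpace.single b₀' (1 : ℝ)) b₂| ≤
        C * (((supDist b₁.src b₂.src : ℕ) : ℝ) / (L : ℝ) ^ j) * Real.exp (-(δ * torusSupNorm (Mk (⟨d + 1, L, m, K, hd, hL⟩ : Params) j)
            (rep (Mk (⟨d + 1, L, m, K, hd, hL⟩ : Params) j) (iterBlockOf j b₁.src) - rep (Mk (⟨d + 1, L, m, K, hd, hL⟩ : Params) j) y))) := by
  obtain ⟨δG, hδG, CG, hCG, hG⟩ := blockBound_GE_scaling d L hd hL one_pos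
  obtain ⟨δP, hδP, CP, hCP, hPG⟩ := holderBound_GE_scaling d L hd hL one_pos
  -- rates: `Q_jG` at `δ₁ = min(δ_G, κ_H/2)`, `H_j(Q_jG)` at `δ₂ = δ₁/2`, the difference at `δ₃ = min(δ₂, δ_P)`
  set κH : ℝ := kappa163 (d + 1) / ((d : ℝ) + 1) with hκH
  have hκH0 : 0 < κH := div_pos (kappa163_pos _) (by positivity)
  set δ₁ : ℝ := min δG (κH / 2) with hδ₁
  have hδ₁0 : 0 < δ₁ := lt_min hδG (half_pos hκH0)
  have hδ₁G : δ₁ ≤ δG := min_le_left _ _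
  have hδ₁H : δ₁ < κH := lt_of_le_of_lt (min_le_right _ _) (half_lt_self hκH0)
  set δ₂ : ℝ := δ₁ / 2 with hδ₂
  have hδ₂0 : 0 < δ₂ := half_pos hδ₁0
  have hδ₂₁ : δ₂ ≤ δ₁ := half_le_self hδ₁0.le
  have hδ₂H : δ₂ < κH := by linarith
  set δ₃ : ℝ := min δ₂ δP with hδ₃
  have hδ₃0 : 0 < δ₃ := lt_min hδ₂0 hδP
  have hδ₃₂ : δ₃ ≤ δ₂ := min_le_left _ _
  have hδ₃P : δ₃ ≤ δP := min_le_right _ _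
  set AH : ℝ := ((d + 1 : ℕ) : ℝ) * (CdecD d * ((1 * (d + 1) : ℕ) : ℝ)) * Real.exp κH with hAH
  have hAH0 : 0 ≤ AH := by have := CdecD_nonneg (d := d); positivity
  set K₁ : ℝ := latticeConst (d + 1) (κH - δ₁) with hK₁
  set K₂ : ℝ := latticeConst (d + 1) (κH - δ₂) with hK₂
  have hK₁0 : 0 ≤ K₁ := latticeConst_nonneg _ (by linarith)
  have hK₂0 : 0 ≤ K₂ := latticeConst_nonneg _ (by linarith)
  have hL0 : 0 < L := by have := hL.2; omega
  haveI : NeZero L := ⟨by omega⟩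
  have hLp : (0 : ℝ) < L := by exact_mod_cast hL0
  set C : ℝ := CP + AH * (Real.exp κH * CG * K₁) * K₂ with hC
  have hC0 : 0 ≤ C := by positivity
  refine ⟨δ₃, hδ₃0, C, hC0, ?_⟩
  intro m K j hc hj Λ' w hw b₁ b₂ hdir hle y
  have hj' : j ≤ m + K := Nat.le_of_succ_le hj
  have hLj : (0 : ℝ) < (L : ℝ) ^ j := by positivity
  have hw' : (0 : ℝ) < 1 * ((L : ℝ) ^ j) ^ (d + 1) := by positivity
  have ht0 : 0 ≤ (((supDist b₁.src b₂.src : ℕ) : ℝ) / (L : ℝ) ^ j) := by positivity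
  have hρ : IsPseudoDist (fun t t' : Site (⟨d + 1, L, m, K, hd, hL⟩ : Params) j => torusSupNorm (Mk (⟨d + 1, L, m, K, hd, hL⟩ : Params) j) (rep (Mk (⟨d + 1, L, m, K, hd, hL⟩ : Params) j) t - rep (Mk (⟨d + 1, L, m, K, hd, hL⟩ : Params) j) t')) := torusDist_isPseudoDist (Mk (⟨d + 1, L, m, K, hd, hL⟩ : Params) j)
  have hK : SumBound (fun t t' : Site (⟨d + 1, L, m, K, hd, hL⟩ : Params) j => torusSupNorm (Mk (⟨d + 1, L, m, K, hd, hL⟩ : Params) j) (rep (Mk (⟨d + 1, L, m, K, hd, hL⟩ : Params) j) t - rep (Mk (⟨d + 1, L, m, K, hd, hL⟩ : Params) j) t')) (fun a => latticeConst (d + 1) a) := torusDist_sumBound (Mk (⟨d + 1, L, m, K, hd, hL⟩ : Params) j)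
  have hGb := hG m K j hj' hc hw'
  have hQ := blockBound_Qv hc hj' Λ' w hκH0.le
  -- `Q_jG` at rate `δ₁`
  have h1 := blockBound_comp hρ hK (tsV1 hc Λ' w).Qv (GE (Domains.whole (P := (⟨d + 1, L, m, K, hd, hL⟩ : Params)) j hj') hc (w := fun _ => 1 * ((L : ℝ) ^ j) ^ (d + 1)) (fun _ => hw'))
    (fun b : PBond (⟨d + 1, L, m, K, hd, hL⟩ : Params) j => b.src) (fun b₀ : PBond (⟨d + 1, L, m, K, hd, hL⟩ : Params) 0 => iterBlockOf j b₀.src) (fun b₀ : PBond (⟨d + 1, L, m, K, hd, hL⟩ : Params) 0 => iterBlockOf j b₀.src)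
    (Cf := Real.exp κH) (Cg := CG) (by positivity) hCG hδ₁0.le hδ₁G hδ₁H hQ hGb
  -- `H_j(Q_jG)`: pair bound at rate `δ₂`
  have hf : ∀ y' : Site (⟨d + 1, L, m, K, hd, hL⟩ : Params) j, ∑ b ∈ univ.filter (fun b : PBond (⟨d + 1, L, m, K, hd, hL⟩ : Params) j => b.src = y'),
      |(tsV1 hc Λ' w).Hj (EuclideanSpace.single b (1 : ℝ)) b₁ - (tsV1 hc Λ' w).Hj (EuclideanSpace.single b (1 : ℝ)) b₂| ≤
      AH * (((supDist b₁.src b₂.src : ℕ) : ℝ) / (L : ℝ) ^ j) * Real.exp (-(κH * torusSupNorm (Mk (⟨d + 1, L, m, K, hd, hL⟩ : Params) j) (rep (Mk (⟨d + 1, L, m, K, hd, hL⟩ : Params) j) (iterBlockOf j b₁.src) - rep (Mk (⟨d + 1, L, m, K, hd, hL⟩ : Params) j) y'))) := by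
    intro y'
    refine (holderBound_Hj hc Λ' hj hw b₁ b₂ hdir hle y').trans (le_of_eq ?_)
    rw [hAH]
  have h2 := holderBound_comp hρ hK (tsV1 hc Λ' w).Hj ((tsV1 hc Λ' w).Qv ∘ₗ GE (Domains.whole (P := (⟨d + 1, L, m, K, hd, hL⟩ : Params)) j hj') hc (w := fun _ => 1 * ((L : ℝ) ^ j) ^ (d + 1)) (fun _ => hw'))
    (fun b : PBond (⟨d + 1, L, m, K, hd, hL⟩ : Params) j => b.src) (fun b₀ : PBond (⟨d + 1, L, m, K, hd, hL⟩ : Params) 0 => iterBlockOf j b₀.src) b₁ b₂ (iterBlockOf j b₁.src)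
    (Cf := AH * (((supDist b₁.src b₂.src : ℕ) : ℝ) / (L : ℝ) ^ j)) (Cg := Real.exp κH * CG * K₁) (by positivity) (by positivity) hδ₂0.le hδ₂₁ hδ₂H hf h1
  -- both at rate `δ₃`
  have h3 := holderBound_mono hρ (GE (Domains.whole (P := (⟨d + 1, L, m, K, hd, hL⟩ : Params)) j hj') hc (w := fun _ => 1 * ((L : ℝ) ^ j) ^ (d + 1)) (fun _ => hw')) (fun b₀ : PBond (⟨d + 1, L, m, K, hd, hL⟩ : Params) 0 => iterBlockOf j b₀.src) b₁ b₂ (iterBlockOf j b₁.src)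
    (C' := CP * (((supDist b₁.src b₂.src : ℕ) : ℝ) / (L : ℝ) ^ j)) (by positivity) le_rfl hδ₃P (hPG m K j hj' hc hw' b₁ b₂ hdir hle)
  have h4 := holderBound_mono hρ ((tsV1 hc Λ' w).Hj ∘ₗ ((tsV1 hc Λ' w).Qv ∘ₗ GE (Domains.whole (P := (⟨d + 1, L, m, K, hd, hL⟩ : Params)) j hj') hc (w := fun _ => 1 * ((L : ℝ) ^ j) ^ (d + 1)) (fun _ => hw')))
    (fun b₀ : PBond (⟨d + 1, L, m, K, hd, hL⟩ : Params) 0 => iterBlockOf j b₀.src) b₁ b₂ (iterBlockOf j b₁.src)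
    (C' := AH * (((supDist b₁.src b₂.src : ℕ) : ℝ) / (L : ℝ) ^ j) * (Real.exp κH * CG * K₁) * K₂) (by positivity) (le_of_eq (by rw [hK₂])) hδ₃₂ h2
  -- `G̃_j = G − H_j(Q_jG)`
  have hGt : (tsV1 hc Λ' w).Gt = GE (Domains.whole (P := (⟨d + 1, L, m, K, hd, hL⟩ : Params)) j hj') hc (w := fun _ => 1 * ((L : ℝ) ^ j) ^ (d + 1)) (fun _ => hw') - (tsV1 hc Λ' w).Hj ∘ₗ ((tsV1 hc Λ' w).Qv ∘ₗ GE (Domains.whole (P := (⟨d + 1, L, m, K, hd, hL⟩ : Params)) j hj') hc (w := fun _ => 1 * ((L : ℝ) ^ j) ^ (d + 1)) (fun _ => hw')) := by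
    rw [Gt_eq_comp_GE hc hj Λ' hw hw', LinearMap.sub_comp, LinearMap.id_comp, LinearMap.comp_assoc]
  rw [hGt]
  have h5 := holderBound_sub (ρ := (fun t t' : Site (⟨d + 1, L, m, K, hd, hL⟩ : Params) j => torusSupNorm (Mk (⟨d + 1, L, m, K, hd, hL⟩ : Params) j) (rep (Mk (⟨d + 1, L, m, K, hd, hL⟩ : Params) j) t - rep (Mk (⟨d + 1, L, m, K, hd, hL⟩ : Params) j) t'))) _ _
    (fun b₀ : PBond (⟨d + 1, L, m, K, hd, hL⟩ : Params) 0 => iterBlockOf j b₀.src) b₁ b₂ (iterBlockOf j b₁.src) h3 h4 y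
  refine h5.trans (le_of_eq ?_)
  rw [hC]
  ring

open Classical in
/-- **THE PAIR (LIPSCHITZ-IN-THE-OUTPUT) BOUND OF `H_jC̃^{(j)}_ΛH_j*`** (at `c = L^j`, weights `a₀n^{d+1} ≤ w ≤ a₁n^{d+1}`): `δ > 0`, `C ≥ 0` depending
on `d, L, a₀, a₁` only; pair bound `(C·t, δ)` — first factor `H_j` (§1), tail `C̃^{(j)}_ΛH_j*` (p22's `blockBound_Ct_scaling`, `blockBound_Hj_adjoint`).
[cite: Balaban1984PropagatorsII, Prop. 2.5 p.246, (2.129) p.245; Balaban1984PropagatorsI, (1.111) p.35] -/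
theorem holderBound_HjCtHj_scaling (d L : ℕ) (hd : 1 ≤ d + 1) (hL : Odd L ∧ 1 < L) {a₀ a₁ : ℝ} (ha₀ : 0 < a₀) (ha₁ : a₀ ≤ a₁) :
    ∃ δ : ℝ, 0 < δ ∧ ∃ C : ℝ, 0 ≤ C ∧ ∀ (m K : ℕ) (j : ℕ) (hc : ((L : ℝ) ^ j) ≠ 0)
      (_hj : j + 1 ≤ (⟨d + 1, L, m, K, hd, hL⟩ : Params).m + (⟨d + 1, L, m, K, hd, hL⟩ : Params).K)
      (Λ' : Finset (Site (⟨d + 1, L, m, K, hd, hL⟩ : Params) (j + 1))) (w : CIdx j Λ' → ℝ)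
      (_hw0 : ∀ i, a₀ * ((L : ℝ) ^ j) ^ (d + 1) ≤ w i) (_hw1 : ∀ i, w i ≤ a₁ * ((L : ℝ) ^ j) ^ (d + 1))
      (b₁ b₂ : PBond (⟨d + 1, L, m, K, hd, hL⟩ : Params) 0) (_hdir : b₁.dir = b₂.dir) (_hle : supDist b₁.src b₂.src ≤ L ^ j) (y : Site (⟨d + 1, L, m, K, hd, hL⟩ : Params) j),
      ∑ b₀' ∈ univ.filter (fun b₀' : PBond (⟨d + 1, L, m, K, hd, hL⟩ : Params) 0 => iterBlockOf j b₀'.src = y),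
          |((tsV1 hc Λ' w).Hj ∘ₗ (tsV1 hc Λ' w).Ct ∘ₗ LinearMap.adjoint (tsV1 hc Λ' w).Hj) (EuclideanSpace.single b₀' (1 : ℝ)) b₁ -
           ((tsV1 hc Λ' w).Hj ∘ₗ (tsV1 hc Λ' w).Ct ∘ₗ LinearMap.adjoint (tsV1 hc Λ' w).Hj) (EuclideanSpace.single b₀' (1 : ℝ)) b₂| ≤
        C * (((supDist b₁.src b₂.src : ℕ) : ℝ) / (L : ℝ) ^ j) * Real.exp (-(δ * torusSupNorm (Mk (⟨d + 1, L, m, K, hd, hL⟩ : Params) j)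
            (rep (Mk (⟨d + 1, L, m, K, hd, hL⟩ : Params) j) (iterBlockOf j b₁.src) - rep (Mk (⟨d + 1, L, m, K, hd, hL⟩ : Params) j) y))) := by
  obtain ⟨δC, hδC, E, hE, hCt⟩ := blockBound_Ct_scaling d L hd hL ha₀ ha₁
  set κH : ℝ := kappa163 (d + 1) / ((d : ℝ) + 1) with hκH
  have hκH0 : 0 < κH := div_pos (kappa163_pos _) (by positivity)
  set δ₁ : ℝ := min (δC / 2) κH with hδ₁
  set δ₂ : ℝ := min (δC / 2) (κH / 2) with hδ₂
  have hδ₁0 : 0 < δ₁ := lt_min (half_pos hδC) hκH0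
  have hδ₂0 : 0 < δ₂ := lt_min (half_pos hδC) (half_pos hκH0)
  have hδ₁C : δ₁ < δC := lt_of_le_of_lt (min_le_left _ _) (half_lt_self hδC)
  have hδ₁H : δ₁ ≤ κH := min_le_right _ _
  have hδ₂₁ : δ₂ ≤ δ₁ := le_min (min_le_left _ _) ((min_le_right _ _).trans (half_le_self hκH0.le))
  have hδ₂H : δ₂ < κH := lt_of_le_of_lt (min_le_right _ _) (half_lt_self hκH0)
  set K₁ : ℝ := latticeConst (d + 1) (δC - δ₁) with hK₁
  set K₂ : ℝ := latticeConst (d + 1) (κH - δ₂) with hK₂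
  have hK₁0 : 0 ≤ K₁ := latticeConst_nonneg _ (by linarith)
  have hK₂0 : 0 ≤ K₂ := latticeConst_nonneg _ (by linarith)
  have hL0 : 0 < L := by have := hL.2; omega
  haveI : NeZero L := ⟨by omega⟩
  have hLp : (0 : ℝ) < L := by exact_mod_cast hL0
  set AD : ℝ := ((d + 1 : ℕ) : ℝ) * (CdecD d * ((1 * (d + 1) : ℕ) : ℝ)) * Real.exp κH with hAD
  have hAD0 : 0 ≤ AD := by have := CdecD_nonneg (d := d); positivity
  set AH : ℝ := MG163 (d + 1) * periodConst (kappa163 (d + 1)) d with hAH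
  have hAH0 : 0 ≤ AH := mul_nonneg (MG163_nonneg _) (periodConst_pos (kappa163_pos _) _).le
  set C : ℝ := AD * (E * (AH * ((d + 1 : ℕ) : ℝ)) * K₁) * K₂ with hC
  have hC0 : 0 ≤ C := by positivity
  refine ⟨δ₂, hδ₂0, C, hC0, ?_⟩
  intro m K j hc hj Λ' w hw0 hw1 b₁ b₂ hdir hle y
  have hj' : j ≤ m + K := Nat.le_of_succ_le hj
  set n : ℝ := ((L : ℝ) ^ j) ^ (d + 1) with hn
  have hn0 : 0 < n := by positivity
  have hLj : (0 : ℝ) < (L : ℝ) ^ j := by positivity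
  have hw : ∀ i, 0 < w i := fun i => lt_of_lt_of_le (by positivity) (hw0 i)
  have ht0 : 0 ≤ (((supDist b₁.src b₂.src : ℕ) : ℝ) / (L : ℝ) ^ j) := by positivity
  have hρ : IsPseudoDist (fun t t' : Site (⟨d + 1, L, m, K, hd, hL⟩ : Params) j => torusSupNorm (Mk (⟨d + 1, L, m, K, hd, hL⟩ : Params) j) (rep (Mk (⟨d + 1, L, m, K, hd, hL⟩ : Params) j) t - rep (Mk (⟨d + 1, L, m, K, hd, hL⟩ : Params) j) t')) := torusDist_isPseudoDist (Mk (⟨d + 1, L, m, K, hd, hL⟩ : Params) j)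
  have hK : SumBound (fun t t' : Site (⟨d + 1, L, m, K, hd, hL⟩ : Params) j => torusSupNorm (Mk (⟨d + 1, L, m, K, hd, hL⟩ : Params) j) (rep (Mk (⟨d + 1, L, m, K, hd, hL⟩ : Params) j) t - rep (Mk (⟨d + 1, L, m, K, hd, hL⟩ : Params) j) t')) (fun a => latticeConst (d + 1) a) := torusDist_sumBound (Mk (⟨d + 1, L, m, K, hd, hL⟩ : Params) j)
  have hcast : (((L ^ j) ^ (d + 1) * (d + 1) : ℕ) : ℝ) = n * ((d + 1 : ℕ) : ℝ) := by rw [hn]; push_cast; ring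
  -- the first factor `H_j`: pair bound `(A_D·t, κ_H)` (§1)
  have hf : ∀ y' : Site (⟨d + 1, L, m, K, hd, hL⟩ : Params) j, ∑ b ∈ univ.filter (fun b : PBond (⟨d + 1, L, m, K, hd, hL⟩ : Params) j => b.src = y'),
      |(tsV1 hc Λ' w).Hj (EuclideanSpace.single b (1 : ℝ)) b₁ - (tsV1 hc Λ' w).Hj (EuclideanSpace.single b (1 : ℝ)) b₂| ≤
      AD * (((supDist b₁.src b₂.src : ℕ) : ℝ) / (L : ℝ) ^ j) * Real.exp (-(κH * torusSupNorm (Mk (⟨d + 1, L, m, K, hd, hL⟩ : Params) j) (rep (Mk (⟨d + 1, L, m, K, hd, hL⟩ : Params) j) (iterBlockOf j b₁.src) - rep (Mk (⟨d + 1, L, m, K, hd, hL⟩ : Params) j) y'))) := by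
    intro y'
    refine (holderBound_Hj hc Λ' hj hw b₁ b₂ hdir hle y').trans (le_of_eq ?_)
    rw [hAD]
  -- the tail `C̃^{(j)}_ΛH_j*` (p22 files 3, 8)
  have hTs : ∀ (b : PBond (⟨d + 1, L, m, K, hd, hL⟩ : Params) j) (y : Site (⟨d + 1, L, m, K, hd, hL⟩ : Params) j),
      ∑ b₀ ∈ univ.filter (fun b₀ : PBond (⟨d + 1, L, m, K, hd, hL⟩ : Params) 0 => iterBlockOf j b₀.src = y),
          |LinearMap.adjoint (tsV1 hc Λ' w).Hj (EuclideanSpace.single b₀ (1 : ℝ)) b| ≤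
        AH * (n * ((d + 1 : ℕ) : ℝ)) * Real.exp (-(κH * torusSupNorm (Mk (⟨d + 1, L, m, K, hd, hL⟩ : Params) j) (rep (Mk (⟨d + 1, L, m, K, hd, hL⟩ : Params) j) b.src - rep (Mk (⟨d + 1, L, m, K, hd, hL⟩ : Params) j) y))) := by
    intro b y
    refine (blockBound_Hj_adjoint hc hj Λ' hw b y).trans (le_of_eq ?_)
    rw [hcast]
  have hCb : ∀ (b : PBond (⟨d + 1, L, m, K, hd, hL⟩ : Params) j) (y : Site (⟨d + 1, L, m, K, hd, hL⟩ : Params) j),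
      ∑ b' ∈ univ.filter (fun b' : PBond (⟨d + 1, L, m, K, hd, hL⟩ : Params) j => b'.src = y), |(tsV1 hc Λ' w).Ct (EuclideanSpace.single b' (1 : ℝ)) b| ≤
        E / n * Real.exp (-(δC * torusSupNorm (Mk (⟨d + 1, L, m, K, hd, hL⟩ : Params) j) (rep (Mk (⟨d + 1, L, m, K, hd, hL⟩ : Params) j) b.src - rep (Mk (⟨d + 1, L, m, K, hd, hL⟩ : Params) j) y))) :=
    fun b y => hCt m K j hc hj Λ' w hw0 hw1 b y
  have hg : ∀ (b : PBond (⟨d + 1, L, m, K, hd, hL⟩ : Params) j) (y : Site (⟨d + 1, L, m, K, hd, hL⟩ : Params) j), ∑ b₀ ∈ univ.filter (fun b₀ : PBond (⟨d + 1, L, m, K, hd, hL⟩ : Params) 0 => iterBlockOf j b₀.src = y),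
      |((tsV1 hc Λ' w).Ct ∘ₗ LinearMap.adjoint (tsV1 hc Λ' w).Hj) (EuclideanSpace.single b₀ (1 : ℝ)) b| ≤
      E / n * (AH * (n * ((d + 1 : ℕ) : ℝ))) * K₁ *
        Real.exp (-(δ₁ * torusSupNorm (Mk (⟨d + 1, L, m, K, hd, hL⟩ : Params) j) (rep (Mk (⟨d + 1, L, m, K, hd, hL⟩ : Params) j) b.src - rep (Mk (⟨d + 1, L, m, K, hd, hL⟩ : Params) j) y))) := by
    intro b y
    have h := blockBound_comp hρ hK (tsV1 hc Λ' w).Ct (LinearMap.adjoint (tsV1 hc Λ' w).Hj)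
      (fun b : PBond (⟨d + 1, L, m, K, hd, hL⟩ : Params) j => b.src) (fun b : PBond (⟨d + 1, L, m, K, hd, hL⟩ : Params) j => b.src) (fun b₀ : PBond (⟨d + 1, L, m, K, hd, hL⟩ : Params) 0 => iterBlockOf j b₀.src)
      (by positivity : 0 ≤ E / n) (by positivity : 0 ≤ AH * (n * ((d + 1 : ℕ) : ℝ))) hδ₁0.le hδ₁H hδ₁C hCb hTs b y
    rw [hK₁]; exact h
  have h := holderBound_comp hρ hK (tsV1 hc Λ' w).Hj ((tsV1 hc Λ' w).Ct ∘ₗ LinearMap.adjoint (tsV1 hc Λ' w).Hj)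
    (fun b : PBond (⟨d + 1, L, m, K, hd, hL⟩ : Params) j => b.src) (fun b₀ : PBond (⟨d + 1, L, m, K, hd, hL⟩ : Params) 0 => iterBlockOf j b₀.src) b₁ b₂ (iterBlockOf j b₁.src)
    (by positivity : 0 ≤ AD * (((supDist b₁.src b₂.src : ℕ) : ℝ) / (L : ℝ) ^ j)) (by positivity : 0 ≤ E / n * (AH * (n * ((d + 1 : ℕ) : ℝ))) * K₁)
    hδ₂0.le hδ₂₁ hδ₂H hf hg y
  refine h.trans (le_of_eq ?_)
  have hn' : E / n * (AH * (n * ((d + 1 : ℕ) : ℝ))) = E * (AH * ((d + 1 : ℕ) : ℝ)) := by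
    field_simp
  rw [hn', hC, hK₁, hK₂]
  ring

end Scaling

end Literature.MathematicalPhysics.QuantumFieldTheory.Balaban1983to89.B6BlockHolderLipFactorsV1

end
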